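import Summits.KontsevichZagierPeriods.Zeta5Search.WedgeDictionaryDescent22Closed
import Summits.KontsevichZagierPeriods.Zeta5Search.WedgeDictionaryVanishing
import Summits.KontsevichZagierPeriods.Zeta5Search.PermutationSaving
import Summits.KontsevichZagierPeriods.Zeta5Search.CellularGroupPermutations
import HarnessLib

/-!
# ζ(5) search — the `P̂`-part on the MIRROR residue range `p₂ + q₂ ≤ p₃`, by the symmetry `i₁` (D2 lane, gen-1 g11)

HONEST FRAMING: systematic search; no irrationality claim unless certified.

Cell `pub-zeta5`, D2 lane, generation g11 (second file of the seat).  Brown–Zudilin (arXiv:2210.03391v3, Sect. 6) read the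
`ζ(3)`-descent (22) off the iterated residue at `|y₄| = |y₅| = ε`, which needs `p₄ + q₄ ≤ p₃`, and remark "one can also choose
`|y₁| = |y₂| = ε` instead".  On the parameter side that choice is the generator `i₁ : a ↦ (a₅,a₄,a₃,a₂,a₁,a₇,a₆,a₄+a₇+a₈−a₂−a₆)`
of their group `G` (Sect. 7; `GeneralFamily.genI1`), and this file makes the remark a KERNEL-CHECKED TRANSPORT of the obligation
node `phatPartResidueLD` (`WedgeDictionaryDescent22Closed`) to the mirror range:

* PROVED, unconditionally, the action of `i₁` on every ingredient of the node: `(p;q)(i₁a)` is the REVERSAL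
  `(p₆,…,p₀; q₅,…,q₁)` (`pOf_genI1`, `qOf_genI1`); the leading coefficient (17) is reversal-symmetric, so **`QOf_genI1 : Q(i₁ a) = Q(a)`**
  (a re-indexing of the double binomial sum over the common support box, `Qcoeff_reverse`); the dual vector is relabelled by the slot
  involution `σ = (1 4)(2 3)(5 7)`, `bOfA_genI1 : b(i₁ a) = σ • b(a)` (`SymmetricGauge.permLower`); `σ` preserves gen-1's pair set `E`
  and the slot set `{1,4,5,6,7}`, so **`rhoB_slotPermI1 : ρ(σ • b) = ρ(b)`** although `ρ` is not `S₇`-invariant; `U, V` are `S₇`-invariant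
  (tree: `coeffU_permLower`, `coeffV_permLower`, `shift_permLower`); the seventeen forms (3) are permuted (`converges_genI1`) and the
  normalisation `∏_{i∈F} h_i!` of (27) is unchanged (`prodF_genI1`, from the tree's `CellularGroup.hForm_genI1`: `F` is `i₁`-stable).
* Hence, from the CITED invariance (27) (`invariance_of_converges'`, used only at the generator `i₁`), `cellularIntegral_genI1 :
  I(i₁ a) = I(a)` for convergent `a`, and the transport **`phatPartLDMirror_of_LD : invariance_of_converges' → phatPartResidueLD →
  phatPartResidueLDMirror`**, where `phatPartResidueLDMirror` is the SAME conclusion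
  `∃ P ∈ ℚ, I(a) = Q(a)(2ζ(5)+4ζ(3)ζ(2)) − 4ρ(a)(U(b)V(b+e_j) − U(b+e_j)V(b))ζ(2) − 2P` under the mirrored hypotheses: residue clause
  `p₂ + q₂ ≤ p₃` in place of `p₄ + q₄ ≤ p₃` and clause 2 relabelled by `σ`, `b₀ − b₄ − b₃ ≤ d + max(0, b₅ − b₄, b₅ − b₃)`; the other eight
  hypotheses are `i₁`-invariant.
* **`phatPartLDMirror_of_descent22 : descent22 → vwp_eq_integral_of_pos → baileyTransformClosed → invariance_of_converges' →
  phatPartResidueLDMirror`** (KERNEL-CHECKED REDUCTION to four cited facts).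

Coverage (exact census, `HOME/code/gen1/g11/mirror_census2.py`, seconds): among the parameter vectors satisfying the eight common
hypotheses, box `{1,…,4}⁸`: 16742 points, original node 8856 (52.9 %), original ∪ mirror 12686 (75.8 %; 3830 new); box `{0,…,3}⁸`:
4968 points, 2758 (55.5 %) → 4011 (80.7 %).  Example of a new point: `a = (1,1,1,1,1,1,2,1)` (`p₄+q₄ = 3 > p₃ = 2`, `p₂+q₂ = 2`).
What this is NOT: the complement of both residue ranges (`p₄+q₄ > p₃` and `p₂+q₂ > p₃`; 4056 of the 16742 points) is not covered; nothing
here proves (22), (27) or the Bailey invariance; nothing about irrationality.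
-/

noncomputable section

open Finset

namespace Summit.KontsevichZagierPeriods.Zeta5Search.WedgeDictionary

open Summit.KontsevichZagierPeriods.Zeta5Search.DualSeries
open Literature.NumberTheory.Irrationality.BrownZudilin2022
open Literature.NumberTheory.Irrationality.Zudilin2002 (vwp_eq_integral_of_pos)
open Literature.NumberTheory.Irrationality.Zudilin2004
open Literature.NumberTheory.Transcendental (zetaValue)
open Summit.KontsevichZagierPeriods.Zeta5Search.SymmetricGauge (permLower permLower_apply_succ permLower_zero
  permLower_apply_of_not coeffU_permLower coeffV_permLower shift_permLower dOf_permLower sum_range7_permLower rhoB rhoOf_eq_rhoB)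
open Summit.KontsevichZagierPeriods.Zeta5Search.CasoratianValuation (shift)
open Summit.KontsevichZagierPeriods.Zeta5Search.CellularGroup (hForm_genI1)

/-! ## 1. The leading coefficient (17) is reversal-symmetric: `Q(i₁ a) = Q(a)` -/

-- (`zchoose_eq_zero` — `C(n,k) = 0` off `0 ≤ k ≤ n` — is reused from `WedgeDictionaryVanishing`.)

/-- Restricting a finite sum to the part of its range where the summand can be non-zero. -/
theorem sum_eq_sum_inter (S S' : Finset ℤ) (F : ℤ → ℤ) (h : ∀ x ∈ S, x ∉ S' → F x = 0) :
    ∑ x ∈ S, F x = ∑ x ∈ S ∩ S', F x :=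
  (Finset.sum_subset Finset.inter_subset_left fun x hx hx' =>
    h x hx fun h' => hx' (Finset.mem_inter.2 ⟨hx, h'⟩)).symm

/-- The summand of (17). -/
def qSummand (p : Fin 7 → ℤ) (q : Fin 5 → ℤ) (k₁ k₂ : ℤ) : ℤ :=
  zchoose k₁ (p 0) * zchoose k₂ (p 6) * zchoose (k₁ + k₂ + q 2 - p 0 - p 6) (p 3 + q 2 - p 0 - p 6)
    * zchoose (q 0) (k₁ - p 1) * zchoose (q 1) (k₁ - p 2) * zchoose (q 3) (k₂ - p 4) * zchoose (q 4) (k₂ - p 5)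

/-- (17) in terms of `qSummand` (definitional). -/
theorem Qcoeff_eq_qSummand (p : Fin 7 → ℤ) (q : Fin 5 → ℤ) :
    Qcoeff p q = (-1) ^ (∑ i, p i).toNat *
      ∑ k₁ ∈ Icc (p 1) (p 1 + q 0), ∑ k₂ ∈ Icc (p 4) (p 4 + q 3), qSummand p q k₁ k₂ := rfl

/-- (17) summed over the common support box `[p₁,p₁+q₁] ∩ [p₂,p₂+q₂] × [p₄,p₄+q₄] ∩ [p₅,p₅+q₅]` (the binomials
`C(q₂,k₁−p₂)`, `C(q₅,k₂−p₅)` vanish outside). -/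
theorem Qcoeff_eq_inter (p : Fin 7 → ℤ) (q : Fin 5 → ℤ) :
    Qcoeff p q = (-1) ^ (∑ i, p i).toNat *
      ∑ k₁ ∈ Icc (p 1) (p 1 + q 0) ∩ Icc (p 2) (p 2 + q 1),
        ∑ k₂ ∈ Icc (p 4) (p 4 + q 3) ∩ Icc (p 5) (p 5 + q 4), qSummand p q k₁ k₂ := by
  rw [Qcoeff_eq_qSummand]
  congr 1
  have inner : ∀ k₁, ∑ k₂ ∈ Icc (p 4) (p 4 + q 3), qSummand p q k₁ k₂ =
      ∑ k₂ ∈ Icc (p 4) (p 4 + q 3) ∩ Icc (p 5) (p 5 + q 4), qSummand p q k₁ k₂ := by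
    intro k₁
    refine sum_eq_sum_inter _ _ _ fun k₂ _ hk₂ => ?_
    simp only [mem_Icc, not_and_or, not_le] at hk₂
    have hz : zchoose (q 4) (k₂ - p 5) = 0 := zchoose_eq_zero (by omega)
    simp [qSummand, hz]
  simp_rw [inner]
  refine sum_eq_sum_inter _ _ _ fun k₁ _ hk₁ => ?_
  simp only [mem_Icc, not_and_or, not_le] at hk₁
  have hz : zchoose (q 1) (k₁ - p 2) = 0 := zchoose_eq_zero (by omega)
  exact Finset.sum_eq_zero fun k₂ _ => by simp [qSummand, hz]

/-- **Reversal symmetry of (17).** If `p' = (p₆,…,p₀)` and `q' = (q₅,…,q₁)` then `Q(p';q') = Q(p;q)`: the summand is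
symmetric under `k₁ ↔ k₂` together with the reversal, and both sums live on the same support box. -/
theorem Qcoeff_reverse (p p' : Fin 7 → ℤ) (q q' : Fin 5 → ℤ)
    (hp : p' 0 = p 6 ∧ p' 1 = p 5 ∧ p' 2 = p 4 ∧ p' 3 = p 3 ∧ p' 4 = p 2 ∧ p' 5 = p 1 ∧ p' 6 = p 0)
    (hq : q' 0 = q 4 ∧ q' 1 = q 3 ∧ q' 2 = q 2 ∧ q' 3 = q 1 ∧ q' 4 = q 0) :
    Qcoeff p' q' = Qcoeff p q := by
  obtain ⟨e0, e1, e2, e3, e4, e5, e6⟩ := hp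
  obtain ⟨f0, f1, f2, f3, f4⟩ := hq
  have hsign : (∑ i, p' i) = ∑ i, p i := by
    simp only [Fin.sum_univ_seven, e0, e1, e2, e3, e4, e5, e6]; ring
  have hsum : ∀ k₁ k₂, qSummand p' q' k₁ k₂ = qSummand p q k₂ k₁ := by
    intro k₁ k₂
    simp only [qSummand, e0, e1, e2, e3, e4, e5, e6, f0, f1, f2, f3, f4]
    rw [show k₁ + k₂ + q 2 - p 6 - p 0 = k₂ + k₁ + q 2 - p 0 - p 6 by ring,
      show p 3 + q 2 - p 6 - p 0 = p 3 + q 2 - p 0 - p 6 by ring]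
    ring
  rw [Qcoeff_eq_inter, Qcoeff_eq_inter p q, hsign]
  congr 1
  simp only [e1, e2, e4, e5, f0, f1, f3, f4]
  simp_rw [hsum]
  rw [Finset.sum_comm, Finset.inter_comm (Icc (p 2) (p 2 + q 1)), Finset.inter_comm (Icc (p 5) (p 5 + q 4))]

/-- `p(i₁ a) = (p₆, p₅, p₄, p₃, p₂, p₁, p₀)(a)`. -/
theorem pOf_genI1 (a : Fin 8 → ℤ) :
    pOf (genI1 a) 0 = pOf a 6 ∧ pOf (genI1 a) 1 = pOf a 5 ∧ pOf (genI1 a) 2 = pOf a 4 ∧ pOf (genI1 a) 3 = pOf a 3 ∧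
      pOf (genI1 a) 4 = pOf a 2 ∧ pOf (genI1 a) 5 = pOf a 1 ∧ pOf (genI1 a) 6 = pOf a 0 := by
  refine ⟨?_, ?_, ?_, ?_, ?_, ?_, ?_⟩ <;> simp [pOf, genI1] <;> ring

/-- `q(i₁ a) = (q₅, q₄, q₃, q₂, q₁)(a)`. -/
theorem qOf_genI1 (a : Fin 8 → ℤ) :
    qOf (genI1 a) 0 = qOf a 4 ∧ qOf (genI1 a) 1 = qOf a 3 ∧ qOf (genI1 a) 2 = qOf a 2 ∧ qOf (genI1 a) 3 = qOf a 1 ∧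
      qOf (genI1 a) 4 = qOf a 0 := by
  refine ⟨?_, ?_, ?_, ?_, ?_⟩ <;> simp [qOf, genI1]
  ring

/-- **`Q(i₁ a) = Q(a)`** for every `a` (no hypotheses). -/
theorem QOf_genI1 (a : Fin 8 → ℤ) : QOf (genI1 a) = QOf a :=
  Qcoeff_reverse _ _ _ _ (pOf_genI1 a) (qOf_genI1 a)

/-! ## 2. The dual side: `b(i₁ a) = σ • b(a)` with `σ = (1 4)(2 3)(5 7)`; `ρ`, `U`, `V`, the forms (3) and `∏_F h_i!` -/

/-- The slot involution `σ = (1 4)(2 3)(5 7)` induced by `i₁`, as a permutation of `Fin 7` (slot `i + 1` ↔ index `i`). -/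
def slotPermI1 : Equiv.Perm (Fin 7) := Equiv.swap 0 3 * Equiv.swap 1 2 * Equiv.swap 4 6

/-- The values of `σ`. -/
theorem slotPermI1_vals : slotPermI1 0 = 3 ∧ slotPermI1 1 = 2 ∧ slotPermI1 2 = 1 ∧ slotPermI1 3 = 0 ∧ slotPermI1 4 = 6 ∧
    slotPermI1 5 = 5 ∧ slotPermI1 6 = 4 := by
  decide

/-- `σ` is an involution. -/
theorem slotPermI1_invol (k : Fin 7) : slotPermI1 (slotPermI1 k) = k := by
  revert k; decide

/-- The relabelled vector, slot by slot: `(σ•b)₀ = b₀`, `(σ•b)₁ = b₄`, `(σ•b)₂ = b₃`, `(σ•b)₃ = b₂`, `(σ•b)₄ = b₁`, `(σ•b)₅ = b₇`,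
`(σ•b)₆ = b₆`, `(σ•b)₇ = b₅`. -/
theorem permLower_slotPermI1_vals (b : ℕ → ℤ) :
    permLower slotPermI1 b 0 = b 0 ∧ permLower slotPermI1 b 1 = b 4 ∧ permLower slotPermI1 b 2 = b 3 ∧
      permLower slotPermI1 b 3 = b 2 ∧ permLower slotPermI1 b 4 = b 1 ∧ permLower slotPermI1 b 5 = b 7 ∧
      permLower slotPermI1 b 6 = b 6 ∧ permLower slotPermI1 b 7 = b 5 := by
  obtain ⟨s0, s1, s2, s3, s4, s5, s6⟩ := slotPermI1_vals
  refine ⟨permLower_zero _ _, ?_, ?_, ?_, ?_, ?_, ?_, ?_⟩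
  · simpa [s0] using permLower_apply_succ slotPermI1 b 0
  · simpa [s1] using permLower_apply_succ slotPermI1 b 1
  · simpa [s2] using permLower_apply_succ slotPermI1 b 2
  · simpa [s3] using permLower_apply_succ slotPermI1 b 3
  · simpa [s4] using permLower_apply_succ slotPermI1 b 4
  · simpa [s5] using permLower_apply_succ slotPermI1 b 5
  · simpa [s6] using permLower_apply_succ slotPermI1 b 6

/-- **`b(i₁ a) = σ • b(a)`.** -/
theorem bOfA_genI1 (a : Fin 8 → ℤ) : bOfA (genI1 a) = permLower slotPermI1 (bOfA a) := by
  obtain ⟨v0, v1, v2, v3, v4, v5, v6, v7⟩ := permLower_slotPermI1_vals (bOfA a)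
  funext i
  by_cases hi : 1 ≤ i ∧ i ≤ 7
  · have : i = 1 ∨ i = 2 ∨ i = 3 ∨ i = 4 ∨ i = 5 ∨ i = 6 ∨ i = 7 := by omega
    rcases this with rfl | rfl | rfl | rfl | rfl | rfl | rfl
    · rw [v1]; simp [bOfA, genI1]; ring
    · rw [v2]; simp [bOfA, genI1]
    · rw [v3]; simp [bOfA, genI1]
    · rw [v4]; simp [bOfA, genI1]; ring
    · rw [v5]; simp [bOfA, genI1]; ring
    · rw [v6]; simp [bOfA, genI1]; ring
    · rw [v7]; simp [bOfA, genI1]; ring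
  · rw [permLower_apply_of_not _ _ hi]
    obtain rfl | hi8 : i = 0 ∨ 8 ≤ i := by omega
    · simp [bOfA, genI1]; ring
    · obtain ⟨k, rfl⟩ : ∃ k, i = k + 8 := ⟨i - 8, by omega⟩
      rfl

/-- **`ρ(σ • b) = ρ(b)`**: `σ` maps gen-1's pair set `E` and the slot set `{1,4,5,6,7}` to themselves (`ρ` is NOT invariant under
all of `S₇`). -/
theorem rhoB_slotPermI1 (b : ℕ → ℤ) : rhoB (permLower slotPermI1 b) = rhoB b := by
  obtain ⟨v0, v1, v2, v3, v4, v5, v6, v7⟩ := permLower_slotPermI1_vals b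
  have hs := sum_range7_permLower slotPermI1 b id
  simp only [id] at hs
  unfold rhoB
  rw [dOf_permLower, hs]
  simp only [Epairs, List.map, List.prod_cons, List.prod_nil, v0, v1, v2, v3, v4, v5, v6, v7]
  ring_nf

/-- Hence **`ρ(i₁ a) = ρ(a)`**. -/
theorem rhoOf_genI1 (a : Fin 8 → ℤ) : rhoOf (genI1 a) = rhoOf a := by
  rw [rhoOf_eq_rhoB, rhoOf_eq_rhoB, bOfA_genI1, rhoB_slotPermI1]

/-- `b + e_j` is the tree's `shift b j` (definitional). -/
theorem update_eq_shift (b : ℕ → ℤ) (j : ℕ) : Function.update b j (b j + 1) = shift b j := rfl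

/-- The convergence cone is `i₁`-stable (the seventeen forms (3) are permuted; `F` of (27) is `i₁`-stable). -/
theorem converges_genI1 {a : Fin 8 → ℤ} (h : Converges a) : Converges (genI1 a) := by
  have h' := (converges_iff_hForm a).1 h
  rw [converges_iff_hForm]
  obtain ⟨h1, h2, h3, h4, h5, h6, h7, -, h9, h10, h11, -, -, h14, -, h16, -, h18, -, h20, -, -, h23, -, -, -, h27, h28⟩ :=
    hForm_genI1 a
  simp only [Fset, List.forall_mem_cons, h1, h2, h3, h4, h5, h6, h7, h9, h10, h11, h14, h16, h18, h20, h23, h27, h28] at h' ⊢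
  simp only [List.not_mem_nil, IsEmpty.forall_iff, implies_true, and_true] at h' ⊢
  omega

/-- The normalisation `∏_{i∈F} h_i(a)!` of (27) is `i₁`-invariant. -/
theorem prodF_genI1 (a : Fin 8 → ℤ) :
    (Fset.map fun i => ((hForm (genI1 a) i).toNat.factorial : ℝ)).prod =
      (Fset.map fun i => ((hForm a i).toNat.factorial : ℝ)).prod := by
  obtain ⟨h1, h2, h3, h4, h5, h6, h7, -, h9, h10, h11, -, -, h14, -, h16, -, h18, -, h20, -, -, h23, -, -, -, h27, h28⟩ :=
    hForm_genI1 a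
  simp only [Fset, List.map, List.prod_cons, List.prod_nil, h1, h2, h3, h4, h5, h6, h7, h9, h10, h11, h14, h16, h18, h20, h23,
    h27, h28]
  ring

/-- **`I(i₁ a) = I(a)`** for convergent `a`, from the cited invariance (27) at the generator `i₁`. -/
theorem cellularIntegral_genI1 (hInv : invariance_of_converges') {a : Fin 8 → ℤ} (h : Converges a) :
    cellularIntegral (genI1 a) = cellularIntegral a := by
  have key := (hInv a h).1 (converges_genI1 h)
  unfold normalisedIntegral' at key
  rw [prodF_genI1] at key
  have hne : (Fset.map fun i => ((hForm a i).toNat.factorial : ℝ)).prod ≠ 0 := by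
    simp only [Fset, List.map, List.prod_cons, List.prod_nil]
    positivity
  exact (div_left_inj' hne).1 key

/-! ## 3. The node on the mirror range and its transport -/

/-- **OBLIGATION NODE — the `P̂`-part on the MIRROR residue range.**  Same conclusion as `phatPartResidueLD`; hypotheses: the eight
`i₁`-invariant ones (convergence, region, `d ≥ 0`, partner condition, LD box `2b_i ≤ b₀`, `p, q ≥ 0`), the mirror residue clause
`p₂ + q₂ ≤ p₃` (Brown–Zudilin's "`|y₁| = |y₂| = ε` instead", Sect. 6) and clause 2 relabelled by `σ = (1 4)(2 3)(5 7)`: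
`b₀ − b₄ − b₃ ≤ d + max(0, b₅ − b₄, b₅ − b₃)`. -/
@[conjecture] def phatPartResidueLDMirror : Prop :=
  ∀ (a : Fin 8 → ℤ) (j : ℕ), j ∈ Icc 1 7 → Converges a →
    (∀ i ∈ Icc 1 7, 0 ≤ bOfA a i ∧ 2 * bOfA a i ≤ bOfA a 0 + 1) → 0 ≤ dOf (bOfA a) →
    2 * (bOfA a j + 1) ≤ bOfA a 0 + 1 → (∀ i ∈ Icc 1 7, 2 * bOfA a i ≤ bOfA a 0) →
    (∀ i, 0 ≤ pOf a i) → (∀ i, 0 ≤ qOf a i) → pOf a 2 + qOf a 1 ≤ pOf a 3 →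
    bOfA a 0 - bOfA a 4 - bOfA a 3 ≤ dOf (bOfA a) + max 0 (max (bOfA a 5 - bOfA a 4) (bOfA a 5 - bOfA a 3)) →
    ∃ P : ℚ, cellularIntegral a =
      (QOf a : ℝ) * (2 * zetaValue 5 + 4 * zetaValue 3 * zetaValue 2) -
        4 * ((rhoOf a * (coeffU (bOfA a) * coeffV (Function.update (bOfA a) j (bOfA a j + 1)) -
              coeffU (Function.update (bOfA a) j (bOfA a j + 1)) * coeffV (bOfA a)) : ℚ) : ℝ) * zetaValue 2 -
        2 * (P : ℝ)

/-! Sanity check (not citable): the new point `a = (1,1,1,1,1,1,2,1)` of the census satisfies all ten hypotheses of the mirror node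
(at every `j`) and violates the residue clause `p₄ + q₄ ≤ p₃` of `phatPartResidueLD`. -/
example :
    let a : Fin 8 → ℤ := ![1, 1, 1, 1, 1, 1, 2, 1]
    Converges a ∧ (∀ i ∈ Icc 1 7, 0 ≤ bOfA a i ∧ 2 * bOfA a i ≤ bOfA a 0 + 1) ∧ 0 ≤ dOf (bOfA a) ∧
      (∀ j ∈ Icc 1 7, 2 * (bOfA a j + 1) ≤ bOfA a 0 + 1) ∧ (∀ i ∈ Icc 1 7, 2 * bOfA a i ≤ bOfA a 0) ∧
      (∀ i, 0 ≤ pOf a i) ∧ (∀ i, 0 ≤ qOf a i) ∧ pOf a 2 + qOf a 1 ≤ pOf a 3 ∧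
      bOfA a 0 - bOfA a 4 - bOfA a 3 ≤ dOf (bOfA a) + max 0 (max (bOfA a 5 - bOfA a 4) (bOfA a 5 - bOfA a 3)) ∧
      ¬ pOf a 4 + qOf a 3 ≤ pOf a 3 := by
  decide

/-- **TRANSPORT (kernel-checked): the node on the residue range implies the node on the mirror range**, given (27) at `i₁`.
Proof: apply `phatPartResidueLD` at `i₁ a` with partner `σ(j)` and rewrite every ingredient back by Sects. 1–2. -/
theorem phatPartLDMirror_of_LD (hInv : invariance_of_converges') (h : phatPartResidueLD) : phatPartResidueLDMirror := by
  intro a j hj hconv hreg hd hpart hbox hp hq hres hcl2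
  obtain ⟨hj1, hj7⟩ := mem_Icc.1 hj
  obtain ⟨m, hjm⟩ : ∃ m : Fin 7, j = m.val + 1 := ⟨⟨j - 1, by omega⟩, by simp only; omega⟩
  have hb : bOfA (genI1 a) = permLower slotPermI1 (bOfA a) := bOfA_genI1 a
  obtain ⟨v0, v1, v2, v3, v4, v5, v6, v7⟩ := permLower_slotPermI1_vals (bOfA a)
  obtain ⟨e0, e1, e2, e3, e4, e5, e6⟩ := pOf_genI1 a
  obtain ⟨f0, f1, f2, f3, f4⟩ := qOf_genI1 a
  -- the ten hypotheses at `i₁ a`, partner `σ(m) + 1`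
  have hj' : (slotPermI1 m).val + 1 ∈ Icc 1 7 := mem_Icc.2 ⟨by omega, by have := (slotPermI1 m).isLt; omega⟩
  have hconv' : Converges (genI1 a) := converges_genI1 hconv
  have hreg' : ∀ i ∈ Icc 1 7, 0 ≤ bOfA (genI1 a) i ∧ 2 * bOfA (genI1 a) i ≤ bOfA (genI1 a) 0 + 1 := by
    intro i hi
    have hi' := mem_Icc.1 hi
    obtain ⟨k, rfl⟩ : ∃ k : Fin 7, i = k.val + 1 := ⟨⟨i - 1, by omega⟩, by simp only; omega⟩
    rw [hb, permLower_apply_succ, permLower_zero]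
    exact hreg _ (mem_Icc.2 ⟨by omega, by have := (slotPermI1 k).isLt; omega⟩)
  have hd' : 0 ≤ dOf (bOfA (genI1 a)) := by rw [hb, dOf_permLower]; exact hd
  have hpart' : 2 * (bOfA (genI1 a) ((slotPermI1 m).val + 1) + 1) ≤ bOfA (genI1 a) 0 + 1 := by
    rw [hb, permLower_apply_succ, slotPermI1_invol, permLower_zero, ← hjm]; exact hpart
  have hbox' : ∀ i ∈ Icc 1 7, 2 * bOfA (genI1 a) i ≤ bOfA (genI1 a) 0 := by
    intro i hi
    have hi' := mem_Icc.1 hi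
    obtain ⟨k, rfl⟩ : ∃ k : Fin 7, i = k.val + 1 := ⟨⟨i - 1, by omega⟩, by simp only; omega⟩
    rw [hb, permLower_apply_succ, permLower_zero]
    exact hbox _ (mem_Icc.2 ⟨by omega, by have := (slotPermI1 k).isLt; omega⟩)
  have hp' : ∀ i, 0 ≤ pOf (genI1 a) i := by
    intro i
    fin_cases i
    · simpa [e0] using hp 6
    · simpa [e1] using hp 5
    · simpa [e2] using hp 4
    · simpa [e3] using hp 3
    · simpa [e4] using hp 2
    · simpa [e5] using hp 1
    · simpa [e6] using hp 0
  have hq' : ∀ i, 0 ≤ qOf (genI1 a) i := by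
    intro i
    fin_cases i
    · simpa [f0] using hq 4
    · simpa [f1] using hq 3
    · simpa [f2] using hq 2
    · simpa [f3] using hq 1
    · simpa [f4] using hq 0
  have hres' : pOf (genI1 a) 4 + qOf (genI1 a) 3 ≤ pOf (genI1 a) 3 := by rw [e4, f3, e3]; exact hres
  have hcl2' : bOfA (genI1 a) 0 - bOfA (genI1 a) 1 - bOfA (genI1 a) 2 ≤
      dOf (bOfA (genI1 a)) + max 0 (max (bOfA (genI1 a) 7 - bOfA (genI1 a) 1) (bOfA (genI1 a) 7 - bOfA (genI1 a) 2)) := by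
    rw [hb, dOf_permLower, v0, v1, v2, v7]; exact hcl2
  -- apply the node at `i₁ a` and transport every ingredient back
  obtain ⟨P, hP⟩ := h (genI1 a) _ hj' hconv' hreg' hd' hpart' hbox' hp' hq' hres' hcl2'
  refine ⟨P, ?_⟩
  rw [cellularIntegral_genI1 hInv hconv, QOf_genI1, rhoOf_genI1, update_eq_shift, hb, shift_permLower, slotPermI1_invol, ← hjm,
    coeffU_permLower, coeffV_permLower, coeffU_permLower, coeffV_permLower] at hP
  rw [update_eq_shift]
  exact hP

/-- **KERNEL-CHECKED REDUCTION of the mirror node to four cited facts**: Brown–Zudilin's (22) (`descent22`), Zudilin's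
series = integral identity (`vwp_eq_integral_of_pos`), the closed-cone Bailey invariance (`baileyTransformClosed`) and the
`G`-invariance (27) (`invariance_of_converges'`, used at `i₁` only). -/
theorem phatPartLDMirror_of_descent22 (h22 : descent22) (hZ : vwp_eq_integral_of_pos) (hBc : baileyTransformClosed)
    (hInv : invariance_of_converges') : phatPartResidueLDMirror :=
  phatPartLDMirror_of_LD hInv (phatPartLD_of_descent22 h22 hZ hBc)

end Summit.KontsevichZagierPeriods.Zeta5Search.WedgeDictionary

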